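import Summits.QuantumFields.YangMills.Theorems.UnitScaleTiltProp7SectET3DeltaPiT3Rows
import Summits.QuantumFields.YangMills.Theorems.UnitScaleTiltProp7SectET3GaugeProjectorT3Rows
import Summits.QuantumFields.YangMills.Theorems.UnitScaleTiltProp7SectET3WilsonHessianT3RealityRows
import HarnessLib

/-!
# Route `UnitScaleTilt`, crux «MinimiserStabilityRegPr» (stmt-QuantumFields-19200, stub EX) ∕ (O″χ) B0 (stmt-QuantumFields-20520), node N06(d = 3), route (α) —
# DEFINITIONS FILE, LAYER 0 BRICK L0b PART 2′ «PINV TWIN» (★★OWNER RULING g28-№4 AMENDED (C2′), 2026-08-28 20:47Z): **`G′ᴾ(U₀)` := THE MOORE–PENROSE PSEUDO-INVERSE OF THE TREE'S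
# `Δ′_a(U₀)` — TOTAL, NO CLASS — and the letters `Pᴾ = 1 − D G′ᴾ R_S D*`, `Δ_πᴾ = Pᴾᵀ Δ^η Pᴾ`, the slot `DeltaPiSlotP`, the reader `H46P`, WITH THE THREE EX ROWS PROVED UNCONDITIONALLY**
# (replaces brick L0b part 2's classed letter `GprimeT`∕`gaugeCorr`∕`DeltaPi`, whose class `PosPrime` is EMPTY — kernel certificate ✓p666656 `Prop7SectET3PosPrimeVacuous.not_posPrime`, 19200 evidence #54)

Cell `ym3-torus` (HUMAN RULING D-0037, YM ladder rung R3 — YM₃ on T³, NOT d = 4, NOT Clay; YM gap NOT proved).  Bytes: width seat `ym3-torus-px16` (gen 2, «px16: PINV-BYTES GO»); filing hand: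
EX knit namer ★w2-19200 g6 (prover Defs rule, `--kind definition --supports stmt-QuantumFields-19200`, review lane).  Bricks L0a (`Prop7SectET3HilbertLetters`), L0c (`N_S`, `R_S`), `Δ′_a`'s
letter `laplacePrimeA` and `Δ^η = DeltaEta` are UNTOUCHED; the old `GprimeT gaugeCorr DeltaPi DeltaPiSlot H46` stay in the tree (append-only) and are SUPERSEDED for the EX lane by the `…P` twins.

THE PRINT.  [Balaban1985BackgroundPropagators] p. 394 (3.24)–(3.25): *«Δ′_a = (Δ^η_U + Q′*aQ′)↾Ω₀ … Its inverse is denoted by G′, or G′(U)»*; p. 419 (3.119): *«⟨A, Δ_πA⟩ = ⟨A − DG′RD*A, Δ(A − DG′RD*A)⟩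
… invariant with respect to gauge transformations determined by λ ∈ N(Q′)»*; p. 420 (3.122) `G⁻¹ = Δ_π + DRD* + Q*aQ`, (3.126) `HB = GQ*(QGQ*)⁻¹B`.

HONESTY CLAUSE (RULING g28-№4 AMENDMENT, binding, verbatim in substance).  `G′ᴾ` below is the pseudo-inverse of the TREE's `Δ′_a = D*D + a·(Q∘D)†(Q∘D)` (intrinsic `Q′ := Q∘D`, ACK 32 (q1)
— withdrawn as a model of print's (3.24) but kept as a letter): it DIFFERS from print's `(Δ^η_U + aQ′*Q′)⁻¹` ((3.18)∕(3.24), `Q′` = the block average of gauge parameters) by a FINITE-RANK correction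
supported on the covariantly-constant (and, through `Q∘D` vs `Q′`, the `Q′`-invisible) gauge parameters.  Every display that carries `hPos : RegPr (α L) U₀ → PosOnto …(DeltaPiSlotP) U₀` reads «[B9]
Thm 3.11 for `G`, transported to the pinv letter modulo that finite-rank bookkeeping», and the (139)-row's supplier note reads «print's (138) + `G′RD*` in |·|₍₁₎ + finite-rank bookkeeping».
KILL CRITERION: if a supplier of `hPos`∕`hOp139` needs more than a finite-rank ∕ standard correction relative to print, (C2′) is dropped for (C1)+L0c′ (print's `Q′`, `N := ker Q′`).

THE CONSTRUCTION ([folklore] linear algebra on a finite-dimensional complex inner-product space).  `Δ′_a(U₀)` is self-adjoint and, for `0 ≤ a`, positive SEMI-definite with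
`re⟪λ, Δ′_aλ⟫ = ‖D_{U₀}λ‖² + a‖Q(D_{U₀}λ)‖²`, so `ker Δ′_a = ker D_{U₀}` (∋ the constant identity parameter at every `U₀`).  With `P₀(U₀) :=` the orthogonal projection onto `ker D_{U₀}`
(Mathlib `Submodule.starProjection`), `Δ′_a + P₀` is positive DEFINITE, and **`G′ᴾ := (Δ′_a + P₀)⁻¹ − P₀`** is the Moore–Penrose pseudo-inverse: `G′ᴾΔ′_aλ = λ − P₀λ` (`kerDProj_` rows), `D P₀ = 0`.
Definition by cases (`dif`) on the positivity of `Δ′_a + P₀`, DISCHARGED for `0 ≤ a` by `laplacePrimeA_add_kerDProj_pos` — so NO class is displayed: every row below carries only `(ha : 0 ≤ a)`.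

WHAT IS DEFINED (member `F`, `h : n ≤ K`, parameters `c₀ cB a`, background `U₀`): **`kerDProj … U₀`** (`P₀`), **`GprimeP … U₀`** (`G′ᴾ`), **`gaugeCorrP … U₀ := 1 − DL2 ∘ G′ᴾ ∘ R_S ∘ DstarL2`** (`Pᴾ`),
**`DeltaPiP … U₀ := Pᴾ† ∘ Δ^η ∘ Pᴾ`**, the slot **`DeltaPiSlotP`**, and the `h46tw` reader **`H46P := Hf … DeltaPiSlotP`** (print's `H` (3.126) at the pinv slot, on the route carriers).
WHAT IS PROVED (all for `0 ≤ a`, EVERY `U₀` — no positivity class): `re_inner_laplacePrimeA` (`= ‖Dλ‖² + a‖QDλ‖²`), `laplacePrimeA_isSymmetric`, `laplacePrimeA_of_mem_kerD` (`Δ′_a k = 0` on `ker D`),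
`kerDProj_apply_mem`∕`DL2_kerDProj`∕`kerDProj_eq_self_of_mem`∕`kerDProj_laplacePrimeA` (`P₀ ∘ Δ′_a = 0`), ★`laplacePrimeA_add_kerDProj_pos`, `GprimeP_eq`, ★★`GprimeP_laplacePrimeA`
(`G′ᴾ(Δ′_aλ) = λ − P₀λ`), ★★`DL2_GprimeP_covLapSite_of_mem_NS` (`D G′ᴾ Δ^η λ = Dλ` on `N_S`), unfoldings `gaugeCorrP_apply`∕`DeltaPiP_apply`∕`DeltaPiSlotP_apply`∕`inner_DeltaPiP`, `DeltaPiP_isSymmetric`,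
and THE THREE EX ROWS, UNCONDITIONAL: ★★★`gaugeCorrP_DL2_of_mem_NS`, ★★★`DeltaPiSlotP_kills_NS`, ★★★`inner_DL2_DeltaPiP_eq_zero` (the texts of ✓`gaugeCorr_DL2_of_mem_NS`∕✓`DeltaPiSlot_kills_NS`∕
✓`inner_DL2_DeltaPi_eq_zero` with `…P` letters and `(ha : 0 ≤ a)` for `(hq : PosPrime …)`).
HONEST SCOPE.  Definitions + finite-dimensional linear algebra; NO estimate; `PosOnto …(DeltaPiSlotP) U₀` ([B9] Thm 3.11 for `G`) is NOT proved (it is the display's `hPos`; its `onto` half is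
✓`Prop7QkOntoOfRegPr.surjective_Qk_of_regPr`); the reality∕trace slot rows are the sequel (P3); not a proof of any stub; nothing continuum ∕ OS ∕ mass-gap ∕ Clay.

References: T. Bałaban, CMP **99** (1985) 389–434 [Balaban1985BackgroundPropagators] ((3.18)–(3.25) pp.393–395, Thm 3.11 p.416, (3.118)–(3.126) pp.419–420); CMP **102** (1985) 277–309
[Balaban1985Variational] ((45)–(46) p.285, (102) p.293).
-/

set_option autoImplicit false

noncomputable section

open scoped InnerProductSpace ComplexConjugate Matrix.Norms.L2Operator

namespace Summit.QuantumFields.YangMills.Theorems.Prop7SectET3DeltaPiPInv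

open Literature.MathematicalPhysics.QuantumFieldTheory.Balaban1983to89
open Literature.MathematicalPhysics.QuantumFieldTheory.Balaban1983to89.T3ContinuumYM3Torus
open B9SectCLatticeCarrier (Bond)
open B9Eq311L2Pairing (WL2)
open B11Eq103H1Complex (SiteL2K BondL2K greenK apply_greenK greenK_apply injective_of_rePosDef)
open Summit.QuantumFields.YangMills.Theorems.Prop7SectET3Transport (periodsT3)
open Summit.QuantumFields.YangMills.Theorems.Prop7SectET3HilbertLetters (W₂ toL2 toL2B DL2 DstarL2 covLapSite adjoint_DL2 inner_covLapSite)
open Summit.QuantumFields.YangMills.Theorems.Prop7SectET3GaugeProjector (QDS NS RS QDS_apply mem_NS_iff RS_apply_covLapSite_of_mem)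
open Summit.QuantumFields.YangMills.Theorems.Prop7SectET3WilsonHessian (DeltaEta DeltaEta_isSymmetric)
open Summit.QuantumFields.YangMills.Theorems.Prop7SectET3CurvedPropagators (PosOnto Hf)
open Summit.QuantumFields.YangMills.Theorems.Prop7SectET3DeltaPi (laplacePrimeA laplacePrimeA_apply_of_mem_NS)

variable (F : T3Family) (n K : ℕ) (h : n ≤ K) (c₀ cB a : ℝ) [Fact (0 < c₀)] [Fact (0 < cB)]

/-! ## §1 `Δ′_a` revisited: the form, symmetry, and the kernel `ker D_{U₀}` -/

variable {F n K h c₀ cB a} in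
/-- **`re⟪λ, Δ′_aλ⟫ = ‖D_{U₀}λ‖² + a·‖Q(D_{U₀}λ)‖²`** for the tree's `Δ′_a = D*D + a·(Q∘D)†(Q∘D)`. [cite: Balaban1985BackgroundPropagators, (3.23)–(3.24) p.394] -/
theorem re_inner_laplacePrimeA (U₀ : GaugeField (F.P K) 0 (Matrix.specialUnitaryGroup (Fin 2) ℂ)) (l : SiteL2K ℂ 3 (periodsT3 F K) c₀ W₂) :
    RCLike.re ⟪l, laplacePrimeA F n K h c₀ cB a U₀ l⟫_ℂ = ‖DL2 F n K c₀ U₀ l‖ ^ 2 + a * ‖QDS F n K h c₀ cB U₀ l‖ ^ 2 := by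
  rw [laplacePrimeA, LinearMap.add_apply, inner_add_right, map_add, LinearMap.smul_apply, inner_smul_right, LinearMap.comp_apply,
    LinearMap.adjoint_inner_right, covLapSite, LinearMap.comp_apply, ← adjoint_DL2, LinearMap.adjoint_inner_right, inner_self_eq_norm_sq]
  have hyy : (⟪QDS F n K h c₀ cB U₀ l, QDS F n K h c₀ cB U₀ l⟫_ℂ).re = ‖QDS F n K h c₀ cB U₀ l‖ ^ 2 := by
    have := inner_self_eq_norm_sq (𝕜 := ℂ) (QDS F n K h c₀ cB U₀ l)
    simpa only [RCLike.re_to_complex] using this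
  have h2 : RCLike.re (((a : ℝ) : ℂ) * ⟪QDS F n K h c₀ cB U₀ l, QDS F n K h c₀ cB U₀ l⟫_ℂ) = a * ‖QDS F n K h c₀ cB U₀ l‖ ^ 2 := by
    rw [RCLike.re_to_complex, Complex.mul_re, Complex.ofReal_re, Complex.ofReal_im, zero_mul, sub_zero, hyy]
  rw [h2]

variable {F n K h c₀ cB a} in
/-- `Δ′_a(U₀)` is symmetric (`D*D = D†D` and `A†A` are). [cite: Balaban1985BackgroundPropagators, (3.24) p.394] -/
theorem laplacePrimeA_isSymmetric (U₀ : GaugeField (F.P K) 0 (Matrix.specialUnitaryGroup (Fin 2) ℂ)) : (laplacePrimeA F n K h c₀ cB a U₀).IsSymmetric := by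
  intro x y
  simp only [laplacePrimeA, LinearMap.add_apply, LinearMap.smul_apply, LinearMap.comp_apply, covLapSite, inner_add_left, inner_add_right, inner_smul_left,
    inner_smul_right, Complex.conj_ofReal]
  rw [← adjoint_DL2, LinearMap.adjoint_inner_left, LinearMap.adjoint_inner_right, LinearMap.adjoint_inner_left, LinearMap.adjoint_inner_right,
    ← LinearMap.adjoint_inner_right (DL2 F n K c₀ U₀) x (DL2 F n K c₀ U₀ y)]

variable {F n K h c₀ cB a} in
/-- `Δ′_a k = 0` for `k ∈ ker D_{U₀}` (the located zero modes; e.g. the constant identity parameter, ✓`Prop7SectET3PosPrimeVacuous`). [cite: Balaban1985BackgroundPropagators, (3.24) p.394] -/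
theorem laplacePrimeA_of_mem_kerD (U₀ : GaugeField (F.P K) 0 (Matrix.specialUnitaryGroup (Fin 2) ℂ)) {k : SiteL2K ℂ 3 (periodsT3 F K) c₀ W₂}
    (hk : k ∈ LinearMap.ker (DL2 F n K c₀ U₀)) : laplacePrimeA F n K h c₀ cB a U₀ k = 0 := by
  have h0 : DL2 F n K c₀ U₀ k = 0 := LinearMap.mem_ker.1 hk
  simp only [laplacePrimeA, LinearMap.add_apply, LinearMap.smul_apply, LinearMap.comp_apply, QDS_apply, covLapSite, h0, map_zero, smul_zero, add_zero]

/-! ## §2 `P₀(U₀)`: the orthogonal projection onto `ker D_{U₀}` -/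

/-- **`P₀(U₀)` — THE ORTHOGONAL PROJECTION ONTO `ker D_{U₀}`** (the covariantly-constant gauge parameters; Mathlib `Submodule.starProjection`, finite dimension supplies completeness).
[cite: Balaban1985BackgroundPropagators, (3.21)–(3.24) p.394] -/
def kerDProj (U₀ : GaugeField (F.P K) 0 (Matrix.specialUnitaryGroup (Fin 2) ℂ)) : SiteL2K ℂ 3 (periodsT3 F K) c₀ W₂ →ₗ[ℂ] SiteL2K ℂ 3 (periodsT3 F K) c₀ W₂ :=
  haveI : CompleteSpace (LinearMap.ker (DL2 F n K c₀ U₀)) := FiniteDimensional.complete ℂ _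
  ((LinearMap.ker (DL2 F n K c₀ U₀)).starProjection : SiteL2K ℂ 3 (periodsT3 F K) c₀ W₂ →L[ℂ] SiteL2K ℂ 3 (periodsT3 F K) c₀ W₂).toLinearMap

variable {F n K c₀} in
/-- `P₀ x ∈ ker D`. [folklore] -/
theorem kerDProj_apply_mem (U₀ : GaugeField (F.P K) 0 (Matrix.specialUnitaryGroup (Fin 2) ℂ)) (x : SiteL2K ℂ 3 (periodsT3 F K) c₀ W₂) :
    kerDProj F n K c₀ U₀ x ∈ LinearMap.ker (DL2 F n K c₀ U₀) := by
  haveI : CompleteSpace (LinearMap.ker (DL2 F n K c₀ U₀)) := FiniteDimensional.complete ℂ _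
  exact (LinearMap.ker (DL2 F n K c₀ U₀)).starProjection_apply_mem x

variable {F n K c₀} in
/-- `D (P₀ x) = 0`. [folklore] -/
theorem DL2_kerDProj (U₀ : GaugeField (F.P K) 0 (Matrix.specialUnitaryGroup (Fin 2) ℂ)) (x : SiteL2K ℂ 3 (periodsT3 F K) c₀ W₂) :
    DL2 F n K c₀ U₀ (kerDProj F n K c₀ U₀ x) = 0 :=
  LinearMap.mem_ker.1 (kerDProj_apply_mem U₀ x)

variable {F n K c₀} in
/-- `P₀ k = k` for `k ∈ ker D`. [folklore] -/
theorem kerDProj_eq_self_of_mem (U₀ : GaugeField (F.P K) 0 (Matrix.specialUnitaryGroup (Fin 2) ℂ)) {k : SiteL2K ℂ 3 (periodsT3 F K) c₀ W₂}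
    (hk : k ∈ LinearMap.ker (DL2 F n K c₀ U₀)) : kerDProj F n K c₀ U₀ k = k := by
  haveI : CompleteSpace (LinearMap.ker (DL2 F n K c₀ U₀)) := FiniteDimensional.complete ℂ _
  exact Submodule.starProjection_eq_self_iff.2 hk

variable {F n K c₀} in
/-- `P₀` is symmetric. [folklore] -/
theorem kerDProj_isSymmetric (U₀ : GaugeField (F.P K) 0 (Matrix.specialUnitaryGroup (Fin 2) ℂ)) : (kerDProj F n K c₀ U₀).IsSymmetric := by
  haveI : CompleteSpace (LinearMap.ker (DL2 F n K c₀ U₀)) := FiniteDimensional.complete ℂ _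
  exact (LinearMap.ker (DL2 F n K c₀ U₀)).starProjection_isSymmetric

variable {F n K c₀} in
/-- `P₀ y = 0` for `y ⊥ ker D`. [folklore] -/
theorem kerDProj_eq_zero_of_mem_orthogonal (U₀ : GaugeField (F.P K) 0 (Matrix.specialUnitaryGroup (Fin 2) ℂ)) {y : SiteL2K ℂ 3 (periodsT3 F K) c₀ W₂}
    (hy : y ∈ (LinearMap.ker (DL2 F n K c₀ U₀))ᗮ) : kerDProj F n K c₀ U₀ y = 0 := by
  haveI : CompleteSpace (LinearMap.ker (DL2 F n K c₀ U₀)) := FiniteDimensional.complete ℂ _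
  exact (Submodule.starProjection_apply_eq_zero_iff _).2 hy

variable {F n K h c₀ cB a} in
/-- `range Δ′_a ⊥ ker D`: `Δ′_a x ∈ (ker D)ᗮ` (symmetry + `Δ′_a(ker D) = 0`), hence **`P₀(Δ′_a x) = 0`**. [cite: Balaban1985BackgroundPropagators, (3.24) p.394] -/
theorem kerDProj_laplacePrimeA (U₀ : GaugeField (F.P K) 0 (Matrix.specialUnitaryGroup (Fin 2) ℂ)) (x : SiteL2K ℂ 3 (periodsT3 F K) c₀ W₂) :
    kerDProj F n K c₀ U₀ (laplacePrimeA F n K h c₀ cB a U₀ x) = 0 := by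
  refine kerDProj_eq_zero_of_mem_orthogonal U₀ ((Submodule.mem_orthogonal _ _).2 fun k hk => ?_)
  rw [← laplacePrimeA_isSymmetric U₀, laplacePrimeA_of_mem_kerD U₀ hk, inner_zero_left]

variable {F n K h c₀ cB a} in
/-- `Δ′_a (P₀ x) = 0`. [folklore] -/
theorem laplacePrimeA_kerDProj (U₀ : GaugeField (F.P K) 0 (Matrix.specialUnitaryGroup (Fin 2) ℂ)) (x : SiteL2K ℂ 3 (periodsT3 F K) c₀ W₂) :
    laplacePrimeA F n K h c₀ cB a U₀ (kerDProj F n K c₀ U₀ x) = 0 :=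
  laplacePrimeA_of_mem_kerD U₀ (kerDProj_apply_mem U₀ x)

variable {F n K h c₀ cB a} in
/-- ★ **`Δ′_a + P₀` IS POSITIVE DEFINITE for `0 ≤ a`, at EVERY background** (`‖Dλ‖² + a‖QDλ‖² + ‖P₀λ‖²`, and `P₀λ = λ` when `Dλ = 0`) — the regularisation that makes the pseudo-inverse a
plain inverse. [cite: Balaban1985BackgroundPropagators, (3.24)–(3.25) p.394] -/
theorem laplacePrimeA_add_kerDProj_pos (ha : 0 ≤ a) (U₀ : GaugeField (F.P K) 0 (Matrix.specialUnitaryGroup (Fin 2) ℂ)) :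
    ∀ x : SiteL2K ℂ 3 (periodsT3 F K) c₀ W₂, x ≠ 0 → 0 < RCLike.re ⟪x, (laplacePrimeA F n K h c₀ cB a U₀ + kerDProj F n K c₀ U₀) x⟫_ℂ := by
  haveI : CompleteSpace (LinearMap.ker (DL2 F n K c₀ U₀)) := FiniteDimensional.complete ℂ _
  intro x hx
  rw [LinearMap.add_apply, inner_add_right, map_add, re_inner_laplacePrimeA]
  have hP : 0 ≤ RCLike.re ⟪x, kerDProj F n K c₀ U₀ x⟫_ℂ := by
    rw [← kerDProj_isSymmetric U₀]
    exact (LinearMap.ker (DL2 F n K c₀ U₀)).re_inner_starProjection_nonneg x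
  by_cases hD : DL2 F n K c₀ U₀ x = 0
  · -- `x ∈ ker D`: `P₀x = x`, so the last term is `‖x‖² > 0`
    have hxk : x ∈ LinearMap.ker (DL2 F n K c₀ U₀) := LinearMap.mem_ker.2 hD
    have hPx : kerDProj F n K c₀ U₀ x = x := kerDProj_eq_self_of_mem U₀ hxk
    rw [hPx, inner_self_eq_norm_sq]
    have hn : 0 < ‖x‖ ^ 2 := by positivity
    nlinarith [sq_nonneg ‖DL2 F n K c₀ U₀ x‖, mul_nonneg ha (sq_nonneg ‖QDS F n K h c₀ cB U₀ x‖)]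
  · have hn : 0 < ‖DL2 F n K c₀ U₀ x‖ ^ 2 := by positivity
    nlinarith [mul_nonneg ha (sq_nonneg ‖QDS F n K h c₀ cB U₀ x‖)]

/-! ## §3 `G′ᴾ := (Δ′_a + P₀)⁻¹ − P₀` — the pseudo-inverse, total -/

open Classical in
/-- **`G′ᴾ(U₀)`, THE MOORE–PENROSE PSEUDO-INVERSE OF THE TREE'S `Δ′_a(U₀)`** (HONESTY CLAUSE in the module docstring): `(Δ′_a + P₀)⁻¹ − P₀` when `Δ′_a + P₀` is positive definite (always, for
`0 ≤ a`: `laplacePrimeA_add_kerDProj_pos`), `0` otherwise — TOTAL, no displayed class. [cite: Balaban1985BackgroundPropagators, (3.25) p.394] -/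
def GprimeP (U₀ : GaugeField (F.P K) 0 (Matrix.specialUnitaryGroup (Fin 2) ℂ)) : SiteL2K ℂ 3 (periodsT3 F K) c₀ W₂ →ₗ[ℂ] SiteL2K ℂ 3 (periodsT3 F K) c₀ W₂ :=
  if hp : ∀ x : SiteL2K ℂ 3 (periodsT3 F K) c₀ W₂, x ≠ 0 → 0 < RCLike.re ⟪x, (laplacePrimeA F n K h c₀ cB a U₀ + kerDProj F n K c₀ U₀) x⟫_ℂ
  then greenK (laplacePrimeA F n K h c₀ cB a U₀ + kerDProj F n K c₀ U₀) hp - kerDProj F n K c₀ U₀ else 0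

variable {F n K h c₀ cB a} in
/-- Unfolding for `0 ≤ a`: `G′ᴾ = (Δ′_a + P₀)⁻¹ − P₀`. [cite: Balaban1985BackgroundPropagators, (3.25) p.394] -/
theorem GprimeP_eq (ha : 0 ≤ a) (U₀ : GaugeField (F.P K) 0 (Matrix.specialUnitaryGroup (Fin 2) ℂ)) :
    GprimeP F n K h c₀ cB a U₀ = greenK (laplacePrimeA F n K h c₀ cB a U₀ + kerDProj F n K c₀ U₀) (laplacePrimeA_add_kerDProj_pos ha U₀) - kerDProj F n K c₀ U₀ := by
  rw [GprimeP, dif_pos (laplacePrimeA_add_kerDProj_pos ha U₀)]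

variable {F n K h c₀ cB a} in
/-- ★★ **THE PSEUDO-INVERSE IDENTITY `G′ᴾ(Δ′_aλ) = λ − P₀λ`** (`(Δ′_a + P₀)(λ − P₀λ) = Δ′_aλ` by `Δ′_aP₀ = 0`, `P₀² = P₀`; then invert, and `P₀Δ′_a = 0`). [cite: Balaban1985BackgroundPropagators, (3.25) p.394] -/
theorem GprimeP_laplacePrimeA (ha : 0 ≤ a) (U₀ : GaugeField (F.P K) 0 (Matrix.specialUnitaryGroup (Fin 2) ℂ)) (l : SiteL2K ℂ 3 (periodsT3 F K) c₀ W₂) :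
    GprimeP F n K h c₀ cB a U₀ (laplacePrimeA F n K h c₀ cB a U₀ l) = l - kerDProj F n K c₀ U₀ l := by
  have hpos := laplacePrimeA_add_kerDProj_pos (n := n) (h := h) (c₀ := c₀) (cB := cB) (a := a) ha U₀
  -- `(Δ′_a + P₀)(λ − P₀λ) = Δ′_aλ`
  have hkey : (laplacePrimeA F n K h c₀ cB a U₀ + kerDProj F n K c₀ U₀) (l - kerDProj F n K c₀ U₀ l) = laplacePrimeA F n K h c₀ cB a U₀ l := by
    rw [LinearMap.add_apply, map_sub, map_sub, laplacePrimeA_kerDProj, sub_zero, kerDProj_eq_self_of_mem U₀ (kerDProj_apply_mem U₀ l), sub_self, add_zero]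
  have hinv : greenK _ hpos (laplacePrimeA F n K h c₀ cB a U₀ l) = l - kerDProj F n K c₀ U₀ l := by
    rw [← hkey, greenK_apply]
  rw [GprimeP_eq ha, LinearMap.sub_apply, hinv, kerDProj_laplacePrimeA, sub_zero]

variable {F n K h c₀ cB a} in
/-- ★★ **`D_{U₀} G′ᴾ Δ^η_{U₀} λ = D_{U₀}λ` FOR `λ ∈ N_S(U₀)`** (`Δ^ηλ = Δ′_aλ` on `N_S`; `G′ᴾΔ′_aλ = λ − P₀λ`; `DP₀ = 0`) — the one fact the three EX rows need.
[cite: Balaban1985BackgroundPropagators, (3.118)–(3.119) p.419, (3.24)–(3.25) p.394] -/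
theorem DL2_GprimeP_covLapSite_of_mem_NS (ha : 0 ≤ a) (U₀ : GaugeField (F.P K) 0 (Matrix.specialUnitaryGroup (Fin 2) ℂ)) {l : SiteL2K ℂ 3 (periodsT3 F K) c₀ W₂}
    (hl : l ∈ NS F n K h c₀ cB U₀) : DL2 F n K c₀ U₀ (GprimeP F n K h c₀ cB a U₀ (covLapSite F n K c₀ U₀ l)) = DL2 F n K c₀ U₀ l := by
  rw [← laplacePrimeA_apply_of_mem_NS (a := a) U₀ hl, GprimeP_laplacePrimeA ha, map_sub, DL2_kerDProj, sub_zero]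

/-! ## §4 `Pᴾ = 1 − DG′ᴾR_SD*`, `Δ_πᴾ = Pᴾᵀ Δ^η Pᴾ`, the slot, the reader `H46P` -/

/-- **`Pᴾ(U₀) := 1 − D G′ᴾ R_S D*`** — (3.119)'s «gauge transformation to the subspace {RD*A = 0}» at the pinv letter. [cite: Balaban1985BackgroundPropagators, (3.119) p.419] -/
def gaugeCorrP (U₀ : GaugeField (F.P K) 0 (Matrix.specialUnitaryGroup (Fin 2) ℂ)) : BondL2K ℂ 3 (periodsT3 F K) c₀ W₂ →ₗ[ℂ] BondL2K ℂ 3 (periodsT3 F K) c₀ W₂ :=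
  LinearMap.id - DL2 F n K c₀ U₀ ∘ₗ GprimeP F n K h c₀ cB a U₀ ∘ₗ RS F n K h c₀ cB U₀ ∘ₗ DstarL2 F n K c₀ U₀

/-- **`Δ_πᴾ(U₀) := Pᴾᵀ Δ^η(U₀) Pᴾ`** — the operator of the form (3.119) at the pinv letter. [cite: Balaban1985BackgroundPropagators, (3.118)–(3.120) p.419] -/
def DeltaPiP (U₀ : GaugeField (F.P K) 0 (Matrix.specialUnitaryGroup (Fin 2) ℂ)) : BondL2K ℂ 3 (periodsT3 F K) c₀ W₂ →ₗ[ℂ] BondL2K ℂ 3 (periodsT3 F K) c₀ W₂ :=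
  LinearMap.adjoint (gaugeCorrP F n K h c₀ cB a U₀) ∘ₗ (DeltaEta F n K c₀ U₀ : BondL2K ℂ 3 (periodsT3 F K) c₀ W₂ →ₗ[ℂ] BondL2K ℂ 3 (periodsT3 F K) c₀ W₂) ∘ₗ
    gaugeCorrP F n K h c₀ cB a U₀

/-- **THE `Δx` SLOT OF BRICK L0d FILLED WITH `Δ_πᴾ`** (so that `laplaceA … DeltaPiSlotP U₀ = Δ_πᴾ + DR_SD* + Q*aQ`). [cite: Balaban1985BackgroundPropagators, (3.122) p.420] -/
def DeltaPiSlotP : GaugeField (F.P K) 0 (Matrix.specialUnitaryGroup (Fin 2) ℂ) → (BondL2K ℂ 3 (periodsT3 F K) c₀ W₂ →ₗ[ℂ] BondL2K ℂ 3 (periodsT3 F K) c₀ W₂) :=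
  fun U₀ => DeltaPiP F n K h c₀ cB a U₀

/-- **THE `h46tw` LETTER AT THE PINV SLOT: `H46P … U₀ := Hf … DeltaPiSlotP U₀`** (print's `H = GQ*(QGQ*)⁻¹` (3.126) with `G = (Δ_πᴾ + DR_SD* + Q*aQ)⁻¹` on `PosOnto …(DeltaPiSlotP) U₀`, read on the
route carriers; twin of ✓`Prop7SectET3DeltaPi.H46`). [cite: Balaban1985BackgroundPropagators, (3.126) p.420; Balaban1985Variational, (45)–(46) p.285] -/
abbrev H46P (U₀ : GaugeField (F.P K) 0 (Matrix.specialUnitaryGroup (Fin 2) ℂ)) : (PBond (F.P n) 0 → Matrix (Fin 2) (Fin 2) ℂ) →ₗ[ℂ] (PBond (F.P K) 0 → Matrix (Fin 2) (Fin 2) ℂ) :=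
  Hf F n K h c₀ cB a (DeltaPiSlotP F n K h c₀ cB a) U₀

variable {F n K h c₀ cB a}

/-- Unfolding `Pᴾ = 1 − DG′ᴾR_SD*`. [cite: Balaban1985BackgroundPropagators, (3.119) p.419] -/
theorem gaugeCorrP_apply (U₀ : GaugeField (F.P K) 0 (Matrix.specialUnitaryGroup (Fin 2) ℂ)) (A : BondL2K ℂ 3 (periodsT3 F K) c₀ W₂) :
    gaugeCorrP F n K h c₀ cB a U₀ A = A - DL2 F n K c₀ U₀ (GprimeP F n K h c₀ cB a U₀ (RS F n K h c₀ cB U₀ (DstarL2 F n K c₀ U₀ A))) := rfl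

/-- Unfolding `Δ_πᴾ = Pᴾᵀ Δ Pᴾ`. [cite: Balaban1985BackgroundPropagators, (3.119) p.419] -/
theorem DeltaPiP_apply (U₀ : GaugeField (F.P K) 0 (Matrix.specialUnitaryGroup (Fin 2) ℂ)) (A : BondL2K ℂ 3 (periodsT3 F K) c₀ W₂) :
    DeltaPiP F n K h c₀ cB a U₀ A = LinearMap.adjoint (gaugeCorrP F n K h c₀ cB a U₀) (DeltaEta F n K c₀ U₀ (gaugeCorrP F n K h c₀ cB a U₀ A)) := rfl

/-- **(3.119) AS A FORM: `⟪A′, Δ_πᴾ A⟫ = ⟪Pᴾ A′, Δ (Pᴾ A)⟫`.** [cite: Balaban1985BackgroundPropagators, (3.119) p.419] -/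
theorem inner_DeltaPiP (U₀ : GaugeField (F.P K) 0 (Matrix.specialUnitaryGroup (Fin 2) ℂ)) (A' A : BondL2K ℂ 3 (periodsT3 F K) c₀ W₂) :
    ⟪A', DeltaPiP F n K h c₀ cB a U₀ A⟫_ℂ = ⟪gaugeCorrP F n K h c₀ cB a U₀ A', DeltaEta F n K c₀ U₀ (gaugeCorrP F n K h c₀ cB a U₀ A)⟫_ℂ := by
  rw [DeltaPiP_apply, LinearMap.adjoint_inner_right]

/-- Unfolding the slot. [cite: Balaban1985BackgroundPropagators, (3.122) p.420] -/
theorem DeltaPiSlotP_apply (U₀ : GaugeField (F.P K) 0 (Matrix.specialUnitaryGroup (Fin 2) ℂ)) : DeltaPiSlotP F n K h c₀ cB a U₀ = DeltaPiP F n K h c₀ cB a U₀ := rfl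

/-- `Δ_πᴾ` is symmetric (`Pᵀ Δ P` with `Δ = Δ^η` symmetric, ✓`DeltaEta_isSymmetric`). [cite: Balaban1985BackgroundPropagators, (3.119) p.419, (3.12) p.392] -/
theorem DeltaPiP_isSymmetric (U₀ : GaugeField (F.P K) 0 (Matrix.specialUnitaryGroup (Fin 2) ℂ)) : (DeltaPiP F n K h c₀ cB a U₀).IsSymmetric := by
  intro x y
  rw [← inner_conj_symm, inner_DeltaPiP, inner_conj_symm]
  have hs := DeltaEta_isSymmetric (n := n) (c₀ := c₀) U₀ (gaugeCorrP F n K h c₀ cB a U₀ x) (gaugeCorrP F n K h c₀ cB a U₀ y)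
  simp only [ContinuousLinearMap.coe_coe] at hs
  rw [hs, ← inner_DeltaPiP]

/-! ## §5 THE THREE EX ROWS, UNCONDITIONAL (for `0 ≤ a`, every `U₀`) -/

/-- ★★★ **THE GAUGE INVARIANCE OF `A ↦ A − DG′ᴾR_SD*A` ON THE RESIDUAL ALGEBRA: `Pᴾ(D_{U₀}λ) = 0` for `λ ∈ N_S(U₀)`** — the text of ✓`gaugeCorr_DL2_of_mem_NS` with `(ha : 0 ≤ a)` for the empty class
`hq : PosPrime …`. [cite: Balaban1985BackgroundPropagators, (3.118)–(3.119) p.419] -/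
theorem gaugeCorrP_DL2_of_mem_NS (ha : 0 ≤ a) {U₀ : GaugeField (F.P K) 0 (Matrix.specialUnitaryGroup (Fin 2) ℂ)} {l : SiteL2K ℂ 3 (periodsT3 F K) c₀ W₂}
    (hl : l ∈ NS F n K h c₀ cB U₀) : gaugeCorrP F n K h c₀ cB a U₀ (DL2 F n K c₀ U₀ l) = 0 := by
  rw [gaugeCorrP_apply]
  show DL2 F n K c₀ U₀ l - DL2 F n K c₀ U₀ (GprimeP F n K h c₀ cB a U₀ (RS F n K h c₀ cB U₀ (covLapSite F n K c₀ U₀ l))) = 0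
  rw [RS_apply_covLapSite_of_mem U₀ hl, DL2_GprimeP_covLapSite_of_mem_NS ha U₀ hl, sub_self]

/-- ★★★ **`Δ_πᴾ(U₀)(D_{U₀}λ) = 0` FOR `λ ∈ N_S(U₀)`** (the text of ✓`DeltaPi_DL2_of_mem_NS`, unconditional). [cite: Balaban1985BackgroundPropagators, (3.119) p.419] -/
theorem DeltaPiP_DL2_of_mem_NS (ha : 0 ≤ a) {U₀ : GaugeField (F.P K) 0 (Matrix.specialUnitaryGroup (Fin 2) ℂ)} {l : SiteL2K ℂ 3 (periodsT3 F K) c₀ W₂}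
    (hl : l ∈ NS F n K h c₀ cB U₀) : DeltaPiP F n K h c₀ cB a U₀ (DL2 F n K c₀ U₀ l) = 0 := by
  rw [DeltaPiP_apply, gaugeCorrP_DL2_of_mem_NS ha hl, map_zero, map_zero]

/-- ★★★ **THE HYPOTHESIS `hΔ` OF THE (3.124) ROWS, DISCHARGED FOR `Δx := DeltaPiSlotP` AT EVERY BACKGROUND** (the text of ✓`DeltaPiSlot_kills_NS`, unconditional).
[cite: Balaban1985BackgroundPropagators, (3.119) p.419, (3.124) p.420] -/
theorem DeltaPiSlotP_kills_NS (ha : 0 ≤ a) {U₀ : GaugeField (F.P K) 0 (Matrix.specialUnitaryGroup (Fin 2) ℂ)} :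
    ∀ l ∈ NS F n K h c₀ cB U₀, DeltaPiSlotP F n K h c₀ cB a U₀ (DL2 F n K c₀ U₀ l) = 0 :=
  fun _ hl => DeltaPiP_DL2_of_mem_NS ha hl

/-- ★★★ **THE HYPOTHESIS `hΔ′` OF THE (3.124)∕E2-133 ROWS AT THE PINV SLOT: `⟪D_{U₀}λ, Δ_πᴾ w⟫ = 0` for `λ ∈ N_S(U₀)`, every `w`** (the text of ✓`inner_DL2_DeltaPi_eq_zero`, unconditional).
[cite: Balaban1985BackgroundPropagators, (3.119) p.419] -/
theorem inner_DL2_DeltaPiP_eq_zero (ha : 0 ≤ a) {U₀ : GaugeField (F.P K) 0 (Matrix.specialUnitaryGroup (Fin 2) ℂ)} :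
    ∀ l ∈ NS F n K h c₀ cB U₀, ∀ w, ⟪DL2 F n K c₀ U₀ l, DeltaPiSlotP F n K h c₀ cB a U₀ w⟫_ℂ = 0 := by
  intro l hl w
  rw [DeltaPiSlotP_apply, inner_DeltaPiP, gaugeCorrP_DL2_of_mem_NS ha hl, inner_zero_left]

end Summit.QuantumFields.YangMills.Theorems.Prop7SectET3DeltaPiPInv

end
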